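import Summits.AtomisticToContinuum.HydrodynamicLimit.Theses.StrongClosureWeakBV

/-!
# Birth skeleton of the crux `GeneralStrongClosureT` (stmt-AtomisticToContinuum-16991)

Route `route-AtomisticToContinuum-StrongClosureWeakBV`, crux decl
`Summit.AtomisticToContinuum.HydrodynamicLimit.Theses.StrongClosureWeakBV.GeneralStrongClosureT`
(STRONG ENTROPIC CLOSURE BEFORE T*, positive horizons: along every subsequence of a hard-sphere flow
family with the `t = 0` law of large numbers, a further subsequence and a bounded, boxed, measurable weak
entropy solution of the 3-D hard-sphere Euler system with the classical datum, which is the in-probability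
limit of the χ-tested empirical fields at every `t < T`). Skeleton registrar
`planner-skel-stmt-AtomisticToContinuum-16991-0`, 2026-08-17 (BC3 birth certificate; re-audit bin REPAIRABLE).

The crux's own docstring names the four mechanisms it merges — "determinism + mesoscale regularity +
local-equilibrium flux closure + free second law, merged in one statement" — and the route's TWO-LAYER PLAN
foresees exactly this glued split (`GeneralDeterminism → GeneralMesoscaleRegularity → GeneralFluxClosure →
GeneralStrongClosureT`, "every child typed at positive horizons `0 < T` from the start"). The four stubs below
ARE these four mechanisms, typed over the crux's own vocabulary (no new analytic object except the limit
functional `L` of S1), each strictly weaker than the crux, jointly implying it by soft logic: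

* `stub_determinism` (S1, concentration — the BoltzmannHypothesis-hard half, size XL): along every
  subsequence `κ` there is a further subsequence `κ ∘ κ'` and DETERMINISTIC limits `L t χ ∈ ℝ × ℝ³ × ℝ` of the
  χ-tested empirical (density, momentum, energy) fields, in probability, at EVERY `t ∈ [0,T)` (no Young
  measure / no macroscopic randomness before T*).
* `stub_mesoscaleRegularity` (S2, a priori bounds + representation, size L): every such deterministic limit
  functional along a reindexing `k` is represented by jointly measurable fields `(ρ', u', θ')`, time-continuous
  into `L¹`, valued on every `[0,T')`, `T' < T`, in a box `0 < m ≤ ρ', θ' ≤ M`, `‖u'‖ ≤ M` with packing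
  `ρ'σ³ ≤ 2η`, whose `t = 0` slice is the classical datum a.e., the LLN then holding along `k` itself towards
  `(∫χρ', ∫χρ'u', ∫χE')(t)` (no vacuum, no concentration, no velocity blow-up before T*).
* `stub_fluxClosure` (S3, local equilibrium — the closure proper, size XL): every boxed regular in-probability
  limit `(ρ', u', θ')` along a reindexing is a WEAK SOLUTION of the five hard-sphere Euler conservation laws
  (mass, three momentum components with `p = ρθ Z(ρσ³)`, energy with `E = ρ(|u|²/2 + 3θ/2)`) on every `[0,T')`,
  with initial term (the momentum and energy FLUXES of the gas close on the conserved fields through the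
  local hard-sphere Gibbs state).
* `stub_entropyAdmissibility` (S4, the free second law, size L): every such limit satisfies the single physical
  entropy inequality `∂ₜ(−ρs) + div(−ρs u) ≤ 0` in `𝒟'` with initial term, `−ρs = −ρ(3/2 log θ − log ρ −
  f_ex(ρσ³))`.
* Composition `GeneralStrongClosureT_of : S1 → S2 → S3 → S4 → GeneralStrongClosureT` (sorry-free; real content:
  common packing threshold `min (min η₁ η₂) (min η₃ η₄)`, common density threshold, S2 ∘ S1 along `κ ∘ κ'`
  (`StrictMono.comp`), and the reassembly of the crux's inline weak-entropy-solution notion `S3 T'` from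
  `Regular3 ∧ WeakHsEuler ∧ EntropyIneq` test function by test function), and `GeneralStrongClosureT_skeleton`
  = the crux modulo the four sorries.

Why each stub is a consequence of the crux (so the split loses nothing): S1 with `L t χ :=` the integrals of
the crux's limit; S2–S4 because in-probability limits under the local Gibbs laws — probability measures for
`σ ≤ 1/2` by the landed `isProbabilityMeasure_localGibbsLaw` — are unique, so any boxed limit along `k` agrees
slice-wise a.e. with the crux's entropic limit along `k ∘ κ'`, and the weak forms `W3` only see `t`-slices
(`t > 0` integrand, `t = 0` initial term; `0 ∈ [0,T)` as `0 < T`). The same lemma closes the zero-law vacuity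
corner of the `∀ (ρ', u', θ')` stubs S3/S4 (their LLN hypotheses are never trivially satisfied for `σ ≤ 1/2`).

Disproof used: no `Disproof.lean` exists for this crux at registration (no `Cruxes/GeneralStrongClosureT/`
directory). Negatives index: the one entry of this line is the PARENT statement `GeneralStrongClosure`
(stmt-9395), refuted-MISSTATED at the empty horizon `T ≤ 0` by
`Theorems.StrongClosureWeakBVGeneralStrongClosure_refuted` (Vitali datum; landed Negative lemma
`Theorems/GeneralStrongClosure/Negative/VitaliWitness.lean`): every stub here carries the repaired hypothesis
`0 < T` after `IsHardSphereEulerSolution σ T ρ u θ` exactly as the crux does, so for every stub the datum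
`(ρ 0, u 0, θ 0)` is smooth and the Vitali witness is not an instance of any of S1–S4.
-/

noncomputable section

open MeasureTheory Filter Set
open scoped Topology

namespace Summit.AtomisticToContinuum.HydrodynamicLimit.Cruxes.GeneralStrongClosureT.Birth

open Literature.MathematicalPhysics.KineticTheory Literature.Analysis.FluidPDE
open Summit.AtomisticToContinuum.HydrodynamicLimit.Theses

/-! ## §0 Objects of the line (verbatim the `let` preludes of the crux, as named definitions) -/

/-- Families of hard-sphere flows of `N + 1` spheres of diameter `σ(N+1)^{-1/3}` on `𝕋³` (the crux's `Φ`). -/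
abbrev Flows (σ : ℝ) : Type :=
  (N : ℕ) → HardSphereFlow (Literature.Analysis.FluidPDE.Torus.geometry (Fin 3)) (hsDiameter σ N) (N + 1)

/-- The space-time weak pairing of a density `a` with flux `F` against a test function `φ`, with initial term
(verbatim the crux's `W3`): `∫_{t>0} ∫_x (a ∂ₜφ + F · ∇ₓφ) + ∫_x a(0,·) φ(0,·)`. -/
def W3 (a : ℝ → T3 → ℝ) (F : ℝ → T3 → V3) (φ : ℝ → T3 → ℝ) : ℝ :=
  (∫ t in Set.Ioi 0, ∫ x, (a t x * Literature.Analysis.FunctionSpaces.Torus.timeDeriv φ t x +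
      inner ℝ (F t x) (Literature.Analysis.FunctionSpaces.Torus.gradient (φ t) x))) + ∫ x, a 0 x * φ 0 x

/-- Regularity conjuncts of the crux's inline weak-solution notion `S3 T`: joint measurability of `ρ, θ, u` and
time-continuity into `L¹(𝕋³)` within `[0,T)`. -/
def Regular3 (T : ℝ) (ρ θ : ℝ → T3 → ℝ) (u : ℝ → T3 → V3) : Prop :=
  (∀ f ∈ [ρ, θ], Measurable (Function.uncurry f)) ∧ Measurable (Function.uncurry u) ∧
    ∀ t ∈ Set.Ico 0 T, Filter.Tendsto (fun s : ℝ => ∫ x, dist (ρ s x, u s x, θ s x) (ρ t x, u t x, θ t x))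
      (nhdsWithin t (Set.Ico 0 T)) (nhds 0)

/-- The five hard-sphere Euler conservation laws in weak form on `[0,T) × 𝕋³` with initial term (verbatim the
conservation conjuncts of the crux's `S3 T`): for every smooth test function supported before `T`, mass,
momentum (`p = hsPressure σ ρ θ`) and energy (`E = totalEnergyDensity ρ u θ`) balance. -/
def WeakHsEuler (σ T : ℝ) (ρ θ : ℝ → T3 → ℝ) (u : ℝ → T3 → V3) : Prop :=
  ∀ φ : ℝ → T3 → ℝ, ContDiff ℝ (⊤ : ℕ∞) (Literature.Analysis.FunctionSpaces.Torus.stLift φ) →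
    (∃ T' < T, ∀ t, T' ≤ t → ∀ x, φ t x = 0) →
    W3 ρ (fun t x => ρ t x • u t x) φ = 0 ∧
    (∀ i : Fin 3, W3 (fun t x => ρ t x * u t x i)
        (fun t x => (ρ t x * u t x i) • u t x + hsPressure σ (ρ t x) (θ t x) • EuclideanSpace.single i (1 : ℝ))
        φ = 0) ∧
    W3 (fun t x => totalEnergyDensity (ρ t x) (u t x) (θ t x))
        (fun t x => (totalEnergyDensity (ρ t x) (u t x) (θ t x) + hsPressure σ (ρ t x) (θ t x)) • u t x) φ = 0

/-- The single physical entropy inequality `∂ₜ(−ρs) + div(−ρs u) ≤ 0` in `𝒟'([0,T) × 𝕋³)` with initial term,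
`−ρs = −ρ(3/2 log θ − log ρ − f_ex(ρσ³))` (verbatim the entropy conjunct of the crux's `S3 T`). -/
def EntropyIneq (σ T : ℝ) (ρ θ : ℝ → T3 → ℝ) (u : ℝ → T3 → V3) : Prop :=
  ∀ φ : ℝ → T3 → ℝ, ContDiff ℝ (⊤ : ℕ∞) (Literature.Analysis.FunctionSpaces.Torus.stLift φ) →
    (∃ T' < T, ∀ t, T' ≤ t → ∀ x, φ t x = 0) → (∀ t x, 0 ≤ φ t x) →
    0 ≤ W3 (fun t x => -(ρ t x * (3 / 2 * Real.log (θ t x) - Real.log (ρ t x) - hsExcessFreeEnergy (ρ t x * σ ^ 3))))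
      (fun t x => -(ρ t x * (3 / 2 * Real.log (θ t x) - Real.log (ρ t x) - hsExcessFreeEnergy (ρ t x * σ ^ 3))) •
        u t x) φ

/-- The box of the crux's `B3 η m M T`: on `[0,T) × 𝕋³`, `m ≤ ρ, θ ≤ M`, `‖u‖ ≤ M`, packing `ρσ³ ≤ η`. -/
def Box3 (σ η m M T : ℝ) (ρ θ : ℝ → T3 → ℝ) (u : ℝ → T3 → V3) : Prop :=
  ∀ t ∈ Set.Ico 0 T, ∀ x, m ≤ ρ t x ∧ ρ t x ≤ M ∧ m ≤ θ t x ∧ θ t x ≤ M ∧ ‖u t x‖ ≤ M ∧ ρ t x * σ ^ 3 ≤ η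

/-- "Boxed and regular before `T` at packing `2η`": on every `[0,T')`, `T' < T`, the triple is `Regular3` and
lies in some box with `0 < m` and packing `≤ 2η` (verbatim the shape of the crux's conclusion (i) minus the
balance laws). -/
def BoxedRegular (σ η T : ℝ) (ρ θ : ℝ → T3 → ℝ) (u : ℝ → T3 → V3) : Prop :=
  ∀ T' < T, Regular3 T' ρ θ u ∧ ∃ m M : ℝ, 0 < m ∧ Box3 σ (2 * η) m M T' ρ θ u

/-- DETERMINISTIC LIMITS along the reindexing `k` at time `t` (the object of S1): for every continuous `χ`
and `δ > 0`, the local-Gibbs probability that the χ-tested (density, momentum, energy) fields of the time-`t`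
configuration deviate by more than `δ` from the deterministic value `L t χ` tends to `0` along `k`. -/
def DetAlong (σ : ℝ) (a₀ : T3 → ℝ) (u₀ : T3 → V3) (θ₀ : T3 → ℝ) (Φ : Flows σ) (k : ℕ → ℕ)
    (L : ℝ → (T3 → ℝ) → ℝ × V3 × ℝ) (t : ℝ) : Prop :=
  ∀ χ : T3 → ℝ, Continuous χ → ∀ δ > (0 : ℝ),
    Filter.Tendsto (fun n : ℕ => localGibbsLaw σ a₀ u₀ θ₀ (k n) (Φ (k n))
      {z | δ < dist (empiricalDensityField ((Φ (k n)).flow t z) χ,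
        empiricalMomentumField ((Φ (k n)).flow t z) χ, empiricalEnergyField ((Φ (k n)).flow t z) χ) (L t χ)})
      Filter.atTop (nhds 0)

/-- The LAW OF LARGE NUMBERS along the reindexing `k` at time `t` towards the fields `(ρ, u, θ)` (verbatim the
crux's `LLk k ρ θ u t`, joint-deviation form): `DetAlong` with `L t χ = (∫χρ, ∫(χρ)u, ∫χE)(t)`. -/
def LLNAlong (σ : ℝ) (a₀ : T3 → ℝ) (u₀ : T3 → V3) (θ₀ : T3 → ℝ) (Φ : Flows σ) (k : ℕ → ℕ)
    (ρ θ : ℝ → T3 → ℝ) (u : ℝ → T3 → V3) (t : ℝ) : Prop :=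
  ∀ χ : T3 → ℝ, Continuous χ → ∀ δ > (0 : ℝ),
    Filter.Tendsto (fun n : ℕ => localGibbsLaw σ a₀ u₀ θ₀ (k n) (Φ (k n))
      {z | δ < dist (empiricalDensityField ((Φ (k n)).flow t z) χ,
        empiricalMomentumField ((Φ (k n)).flow t z) χ, empiricalEnergyField ((Φ (k n)).flow t z) χ)
        (∫ x, χ x * ρ t x, ∫ x, (χ x * ρ t x) • u t x, ∫ x, χ x * totalEnergyDensity (ρ t x) (u t x) (θ t x))})
      Filter.atTop (nhds 0)

/-! ## §1 Stub signatures

Every stub carries the crux's own hypothesis prefix verbatim — packing level `0 < η ≤ η₀`, continuous positive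
profiles, `σ < σ₀(η, profiles)`, a classical solution on `[0,T)` WITH `0 < T` (the 2026-08-17 repair), the
packing guard `ρσ³ ≤ η`, a flow family and the `t = 0` law of large numbers — so that no stub meets the
Vitali witness of the refuted parent statement. The registered obligation is `theorem stub_<name> :
Sig.stub_<name> := by sorry` (§2); the composition takes the four signatures as hypotheses BY NAME. -/

/-- **S1 — DETERMINISM before T* (concentration; size XL, the BoltzmannHypothesis-hard half).** Under the crux's
hypotheses, along every subsequence `κ` there is a further subsequence `κ ∘ κ'` and a deterministic limit
functional `L : [time] → [test function] → ℝ × ℝ³ × ℝ` such that at EVERY `t ∈ [0,T)` the χ-tested empirical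
density / momentum / energy fields converge in probability to `L t χ` along `κ ∘ κ'` (`DetAlong`). Why
plausibly true: tightness of the tested fields (mass `≤ ‖χ‖∞`, momentum/energy moments from energy
conservation + local Gibbs tails) gives converging LAWS along subsequences for countably many `(t, χ)`;
equicontinuity in `t` of the tested density/momentum/energy (finite-speed transport of mass, momentum flux
bounded by energy) spreads this to every `t`; the content is that the limit laws are DIRAC — macroscopic
randomness cannot be created before T* from local-Gibbs data (relative entropy / large deviations w.r.t. the
time-evolved local Gibbs state, Yau's method without noise). Why it might fail: the crux's own why-line —
unproved for any deterministic interacting Hamiltonian system (OVY1993 needs noise;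
`Literature.Barriers.AtomisticToContinuum.BoltzmannHypothesisBarrier`). Leans on: `localGibbsLaw`,
`TendstoHydroFieldsAt`, `HardSphereFlow` (Liouville invariance, energy conservation). -/
def Sig.stub_determinism : Prop :=
  ∃ η₀ > (0 : ℝ), ∀ η, 0 < η → η ≤ η₀ →
    ∀ a₀ θ₀ : T3 → ℝ, ∀ u₀ : T3 → V3, Continuous a₀ → Continuous θ₀ → Continuous u₀ →
      (∀ x, 0 < a₀ x ∧ 0 < θ₀ x) → ∃ σ₀ > (0 : ℝ), ∀ σ, 0 < σ → σ < σ₀ →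
        ∀ (T : ℝ) (ρ θ : ℝ → T3 → ℝ) (u : ℝ → T3 → V3), IsHardSphereEulerSolution σ T ρ u θ → 0 < T →
          (∀ t ∈ Set.Ico 0 T, ∀ x, ρ t x * σ ^ 3 ≤ η) →
          ∀ Φ : Flows σ, TendstoHydroFieldsAt (fun N => localGibbsLaw σ a₀ u₀ θ₀ N (Φ N)) Φ ρ u θ 0 →
            ∀ κ : ℕ → ℕ, StrictMono κ → ∃ κ' : ℕ → ℕ, StrictMono κ' ∧
              ∃ L : ℝ → (T3 → ℝ) → ℝ × V3 × ℝ, ∀ t ∈ Set.Ico 0 T, DetAlong σ a₀ u₀ θ₀ Φ (κ ∘ κ') L t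

/-- **S2 — MESOSCALE REGULARITY / A PRIORI BOUNDS before T* (size L).** Under the crux's hypotheses, every
deterministic limit functional `L` of the tested fields along a reindexing `k` (S1's conclusion, at every
`t ∈ [0,T)`) is REPRESENTED by fields `(ρ', u', θ')` that are `BoxedRegular` (jointly measurable,
time-continuous into `L¹`, on every `[0,T')` in a box `0 < m ≤ ρ', θ' ≤ M`, `‖u'‖ ≤ M`, packing `≤ 2η`), have the
classical datum as `t = 0` slice a.e., and towards which the LLN holds along `k` itself (`LLNAlong`). Why
plausibly true: the limit functionals are positive, mass-normalised and (by the energy bound) dominated, hence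
measures with `L∞` densities by mesoscale self-averaging of block fields; no vacuum / no over-packing / bounded
velocity and temperature persist from the boxed classical datum for `t < T` by finite propagation and the
entropy bound (packing `≤ 2η` is the route's chosen margin); `t = 0` is pinned by the hypothesis LLN (`0 < T`).
Why it might fail: a priori `L∞` bounds (lower density bound in particular) for particle limits are unproved
even where the PDE has them; time-continuity into `L¹` at every `t` is genuine regularity. Leans on:
`IsHardSphereEulerSolution` (smooth positive datum), `TendstoHydroFieldsAt`, `localGibbsLaw`. -/
def Sig.stub_mesoscaleRegularity : Prop :=
  ∃ η₀ > (0 : ℝ), ∀ η, 0 < η → η ≤ η₀ →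
    ∀ a₀ θ₀ : T3 → ℝ, ∀ u₀ : T3 → V3, Continuous a₀ → Continuous θ₀ → Continuous u₀ →
      (∀ x, 0 < a₀ x ∧ 0 < θ₀ x) → ∃ σ₀ > (0 : ℝ), ∀ σ, 0 < σ → σ < σ₀ →
        ∀ (T : ℝ) (ρ θ : ℝ → T3 → ℝ) (u : ℝ → T3 → V3), IsHardSphereEulerSolution σ T ρ u θ → 0 < T →
          (∀ t ∈ Set.Ico 0 T, ∀ x, ρ t x * σ ^ 3 ≤ η) →
          ∀ Φ : Flows σ, TendstoHydroFieldsAt (fun N => localGibbsLaw σ a₀ u₀ θ₀ N (Φ N)) Φ ρ u θ 0 →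
            ∀ k : ℕ → ℕ, StrictMono k → ∀ L : ℝ → (T3 → ℝ) → ℝ × V3 × ℝ,
              (∀ t ∈ Set.Ico 0 T, DetAlong σ a₀ u₀ θ₀ Φ k L t) →
              ∃ ρ' θ' : ℝ → T3 → ℝ, ∃ u' : ℝ → T3 → V3,
                BoxedRegular σ η T ρ' θ' u' ∧
                (∀ᵐ x : T3, ρ' 0 x = ρ 0 x ∧ u' 0 x = u 0 x ∧ θ' 0 x = θ 0 x) ∧
                ∀ t ∈ Set.Ico 0 T, LLNAlong σ a₀ u₀ θ₀ Φ k ρ' θ' u' t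

/-- **S3 — LOCAL-EQUILIBRIUM FLUX CLOSURE (size XL; the closure proper).** Under the crux's hypotheses, every
`BoxedRegular` triple `(ρ', u', θ')` that is the in-probability limit of the tested fields along a reindexing `k`
at every `t ∈ [0,T)` is, on every `[0,T')`, `T' < T`, a WEAK SOLUTION of the hard-sphere Euler system
(`WeakHsEuler`: mass, the three momentum components with `p = ρθ Z(ρσ³)`, energy, initial term included).
Why plausibly true: mass balance is kinematic (landed `MassContinuity` pattern); for momentum and energy the
microscopic fluxes (kinetic `Σ vᵢ⊗vᵢ`, collisional transfer at contact, energy current) tested against `∇φ`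
must be shown to close, in probability, on the local hard-sphere Gibbs state with the limit's parameters —
local equilibrium propagated before T* (relative entropy w.r.t. the evolved local Gibbs state + virial /
contact-value theorem giving `p = ρθZ(ρσ³)`), velocity tails giving uniform integrability of the energy
current. Why it might fail: the ergodic / local-equilibrium step is exactly what no one can do without noise
(OVY1993; BoltzmannHypothesisBarrier), and the energy-current tightness is an extra moment bound. Leans on:
`hsPressure`, `hsCompressibility`, `totalEnergyDensity`, `localGibbsLaw`, `Torus.timeDeriv/gradient`. -/
def Sig.stub_fluxClosure : Prop :=
  ∃ η₀ > (0 : ℝ), ∀ η, 0 < η → η ≤ η₀ →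
    ∀ a₀ θ₀ : T3 → ℝ, ∀ u₀ : T3 → V3, Continuous a₀ → Continuous θ₀ → Continuous u₀ →
      (∀ x, 0 < a₀ x ∧ 0 < θ₀ x) → ∃ σ₀ > (0 : ℝ), ∀ σ, 0 < σ → σ < σ₀ →
        ∀ (T : ℝ) (ρ θ : ℝ → T3 → ℝ) (u : ℝ → T3 → V3), IsHardSphereEulerSolution σ T ρ u θ → 0 < T →
          (∀ t ∈ Set.Ico 0 T, ∀ x, ρ t x * σ ^ 3 ≤ η) →
          ∀ Φ : Flows σ, TendstoHydroFieldsAt (fun N => localGibbsLaw σ a₀ u₀ θ₀ N (Φ N)) Φ ρ u θ 0 →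
            ∀ k : ℕ → ℕ, StrictMono k → ∀ (ρ' θ' : ℝ → T3 → ℝ) (u' : ℝ → T3 → V3),
              BoxedRegular σ η T ρ' θ' u' → (∀ t ∈ Set.Ico 0 T, LLNAlong σ a₀ u₀ θ₀ Φ k ρ' θ' u' t) →
                ∀ T' < T, WeakHsEuler σ T' ρ' θ' u'

/-- **S4 — ENTROPY ADMISSIBILITY, the free second law (size L).** Under the crux's hypotheses, every
`BoxedRegular` in-probability limit `(ρ', u', θ')` along a reindexing satisfies on every `[0,T')`, `T' < T`, the
single physical entropy inequality `∂ₜ(−ρs) + div(−ρs u) ≤ 0` weakly with initial term (`EntropyIneq`). Why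
plausibly true: the Gibbs/Boltzmann entropy of the law is conserved by the Liouville flow while the
macroscopic entropy `∫ρs` of the limit fields can only exceed the (negative) relative entropy density of the law
w.r.t. local Gibbs states with the limit's parameters (Gibbs variational principle / large deviations upper
bound, blockwise); at `t = 0` equality holds for local Gibbs data, whence the inequality in `𝒟'` with the right
initial term. Why it might fail: the blockwise variational bound needs local equilibrium in entropy sense at
every `t` (not only in probability), and the hard-sphere excess free energy `f_ex` enters through the
unclamped `hsExcessFreeEnergy` exactly as typed. Leans on: `hsExcessFreeEnergy`, `localGibbsLaw`,
`HardSphereFlow.measurePreserving`. -/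
def Sig.stub_entropyAdmissibility : Prop :=
  ∃ η₀ > (0 : ℝ), ∀ η, 0 < η → η ≤ η₀ →
    ∀ a₀ θ₀ : T3 → ℝ, ∀ u₀ : T3 → V3, Continuous a₀ → Continuous θ₀ → Continuous u₀ →
      (∀ x, 0 < a₀ x ∧ 0 < θ₀ x) → ∃ σ₀ > (0 : ℝ), ∀ σ, 0 < σ → σ < σ₀ →
        ∀ (T : ℝ) (ρ θ : ℝ → T3 → ℝ) (u : ℝ → T3 → V3), IsHardSphereEulerSolution σ T ρ u θ → 0 < T →
          (∀ t ∈ Set.Ico 0 T, ∀ x, ρ t x * σ ^ 3 ≤ η) →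
          ∀ Φ : Flows σ, TendstoHydroFieldsAt (fun N => localGibbsLaw σ a₀ u₀ θ₀ N (Φ N)) Φ ρ u θ 0 →
            ∀ k : ℕ → ℕ, StrictMono k → ∀ (ρ' θ' : ℝ → T3 → ℝ) (u' : ℝ → T3 → V3),
              BoxedRegular σ η T ρ' θ' u' → (∀ t ∈ Set.Ico 0 T, LLNAlong σ a₀ u₀ θ₀ Φ k ρ' θ' u' t) →
                ∀ T' < T, EntropyIneq σ T' ρ' θ' u'

/-! ## §2 Stubs (registered; `sorry` only inside them) — hardest: `stub_fluxClosure` (with `stub_determinism`) -/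

/-- **S1 (XL).** Determinism: deterministic in-probability limits of the tested fields at every `t < T` along a
further subsequence. -/
theorem stub_determinism : Sig.stub_determinism := by
  sorry

/-- **S2 (L).** Mesoscale regularity / a priori bounds: deterministic limits are boxed regular fields with the
classical datum. -/
theorem stub_mesoscaleRegularity : Sig.stub_mesoscaleRegularity := by
  sorry

/-- **S3 (XL; the closure proper).** Boxed regular in-probability limits are weak solutions of hard-sphere
Euler. -/
theorem stub_fluxClosure : Sig.stub_fluxClosure := by
  sorry

/-- **S4 (L).** Boxed regular in-probability limits satisfy the physical entropy inequality. -/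
theorem stub_entropyAdmissibility : Sig.stub_entropyAdmissibility := by
  sorry

/-! ## §3 Composition (sorry-free) -/

/-- **The line closes the crux modulo its stubs**: `GeneralStrongClosureT` BY NAME from S1–S4. Real content: the
common packing threshold `min (min η₁ η₂) (min η₃ η₄)`, the common density threshold
`min (min σ₁ σ₂) (min σ₃ σ₄)`, representation (S2) of the deterministic limits (S1) along `κ ∘ κ'`, and the
reassembly of the crux's inline weak-entropy-solution notion on each `[0,T')` from `Regular3`, `WeakHsEuler`
(S3) and `EntropyIneq` (S4), test function by test function. -/
theorem GeneralStrongClosureT_of (h₁ : Sig.stub_determinism) (h₂ : Sig.stub_mesoscaleRegularity)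
    (h₃ : Sig.stub_fluxClosure) (h₄ : Sig.stub_entropyAdmissibility) :
    StrongClosureWeakBV.GeneralStrongClosureT := by
  obtain ⟨η₁, hη₁, H₁⟩ := h₁
  obtain ⟨η₂, hη₂, H₂⟩ := h₂
  obtain ⟨η₃, hη₃, H₃⟩ := h₃
  obtain ⟨η₄, hη₄, H₄⟩ := h₄
  refine ⟨min (min η₁ η₂) (min η₃ η₄), lt_min (lt_min hη₁ hη₂) (lt_min hη₃ hη₄), ?_⟩
  intro η hη hηle a₀ θ₀ u₀ ha hθ hu hpos
  have hle₁ : η ≤ η₁ := hηle.trans ((min_le_left _ _).trans (min_le_left _ _))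
  have hle₂ : η ≤ η₂ := hηle.trans ((min_le_left _ _).trans (min_le_right _ _))
  have hle₃ : η ≤ η₃ := hηle.trans ((min_le_right _ _).trans (min_le_left _ _))
  have hle₄ : η ≤ η₄ := hηle.trans ((min_le_right _ _).trans (min_le_right _ _))
  obtain ⟨σ₁, hσ₁, G₁⟩ := H₁ η hη hle₁ a₀ θ₀ u₀ ha hθ hu hpos
  obtain ⟨σ₂, hσ₂, G₂⟩ := H₂ η hη hle₂ a₀ θ₀ u₀ ha hθ hu hpos
  obtain ⟨σ₃, hσ₃, G₃⟩ := H₃ η hη hle₃ a₀ θ₀ u₀ ha hθ hu hpos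
  obtain ⟨σ₄, hσ₄, G₄⟩ := H₄ η hη hle₄ a₀ θ₀ u₀ ha hθ hu hpos
  refine ⟨min (min σ₁ σ₂) (min σ₃ σ₄), lt_min (lt_min hσ₁ hσ₂) (lt_min hσ₃ hσ₄), ?_⟩
  intro σ hσ hσlt
  have hσ₁' : σ < σ₁ := hσlt.trans_le ((min_le_left _ _).trans (min_le_left _ _))
  have hσ₂' : σ < σ₂ := hσlt.trans_le ((min_le_left _ _).trans (min_le_right _ _))
  have hσ₃' : σ < σ₃ := hσlt.trans_le ((min_le_right _ _).trans (min_le_left _ _))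
  have hσ₄' : σ < σ₄ := hσlt.trans_le ((min_le_right _ _).trans (min_le_right _ _))
  dsimp only
  intro T ρ θ u hsol hT hguard Φ hLLN0 κ hκ
  -- S1: determinism along a further subsequence `κ ∘ κ'`
  obtain ⟨κ', hκ', L, hL⟩ := G₁ σ hσ hσ₁' T ρ θ u hsol hT hguard Φ hLLN0 κ hκ
  -- S2: representation of the deterministic limits by boxed regular fields with the classical datum
  obtain ⟨ρ', θ', u', hBR, hinit, hLL⟩ :=
    G₂ σ hσ hσ₂' T ρ θ u hsol hT hguard Φ hLLN0 (κ ∘ κ') (hκ.comp hκ') L hL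
  refine ⟨κ', hκ', ρ', θ', u', fun T' hT' => ?_, hinit, hLL⟩
  obtain ⟨hR, m, M, hm, hB⟩ := hBR T' hT'
  -- S3/S4: the limit is a weak entropy solution on `[0, T')`
  have hW : WeakHsEuler σ T' ρ' θ' u' :=
    G₃ σ hσ hσ₃' T ρ θ u hsol hT hguard Φ hLLN0 (κ ∘ κ') (hκ.comp hκ') ρ' θ' u' hBR hLL T' hT'
  have hE : EntropyIneq σ T' ρ' θ' u' :=
    G₄ σ hσ hσ₄' T ρ θ u hsol hT hguard Φ hLLN0 (κ ∘ κ') (hκ.comp hκ') ρ' θ' u' hBR hLL T' hT'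
  exact ⟨⟨hR.1, hR.2.1, hR.2.2, fun φ hφ hsupp =>
      ⟨(hW φ hφ hsupp).1, (hW φ hφ hsupp).2.1, (hW φ hφ hsupp).2.2, hE φ hφ hsupp⟩⟩,
    m, M, hm, hB⟩

/-- The skeleton instantiated: the crux modulo the four registered stubs. -/
theorem GeneralStrongClosureT_skeleton : StrongClosureWeakBV.GeneralStrongClosureT :=
  GeneralStrongClosureT_of stub_determinism stub_mesoscaleRegularity stub_fluxClosure
    stub_entropyAdmissibility

end Summit.AtomisticToContinuum.HydrodynamicLimit.Cruxes.GeneralStrongClosureT.Birth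

end
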